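import Literature.MathematicalPhysics.QuantumFieldTheory.Balaban1983to89.B3VertexTensorBounds

/-!
# `Balaban1983to89.B3Eq115RemainderAnalytic` — T. Bałaban, *(Higgs)₂,₃ quantum fields in a finite volume. III.
Renormalization*, Commun. Math. Phys. **88** (1983) 411–445 [Balaban1983Higgs3], p. 414 [PDF 4], the sentence after (1.15):
*"Finally let us recall that R_{n̄+1}(qA) is an analytic function of A ∈ R with values in linear operators on R^N satisfying
the inequality |R_{n̄+1}(qA)| ≦ 1."* — its ANALYTICITY clause PROVED (the inequality is r15's
`B3VertexTensorBounds.norm_remOp_q_le_one`, p342938), together with [Balaban1982Higgs1] (3.14) p. 614 [PDF 12]: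
*"R_{n̄+1}(z) is an analytic function of z defined by the formula R_{n̄+1}(z) = (n̄+1)∫₀¹(1−t)^{n̄}e^{tz}dt"*

statement-level skeleton of published theorems with citation tags; proofs where landed; nothing here is a claim about
the Yang–Mills mass gap

CITATION HEADER (lean-in-tree rule).  lit-balaban TYPED SKELETON (HOME `run/shared/lean/pub/lit-balaban/`), rows
**B3.Eq1.12-1.15** (owner r15; the p. 414 sentence; cells only) and **B1.Eq3.14** (owner r12).  LOCATED MEMBER, no head claim.
Unit `lit-balaban-typer` gen 29 (literature-prover-lit-balaban-typer-g29-0).  Carrier: r15's `B3VertexTensorBounds.taylorRemOp n X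
= (n+1)∫₀¹(1−t)ⁿ exp(tX) dt` in a complete normed real algebra `𝔸` (p342938), `HiggsLattice.ChargeData` (`q`, `e`).

THE ARGUMENT (ours; print states the fact).  Expanding `exp(t·aY) = Σ_j (t a)^j Y^j / j!` under the integral (dominated
convergence, the exponential series dominating uniformly in `t ∈ [0,1]`) gives the everywhere-convergent power series
`R_{n+1}(aY) = Σ_{j≥0} β_j(n) a^j Y^j`, `β_j(n) = (n+1)∫₀¹(1−t)ⁿ t^j/j! dt`, `|β_j(n)| ≦ (n+1)/j!`; hence `a ↦ R_{n+1}(aY)` has a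
formal power series of infinite radius at `0` and is (real-)analytic at every `a ∈ ℝ` (Mathlib `HasFPowerSeriesOnBall`,
`AnalyticAt`).

WHAT IS PROVED (theorems + two definitions with bodies; no `Prop` fact; axioms standard):
* `remCoeff n j = β_j(n)` (def), `abs_remCoeff_le` (`|β_j| ≦ (n+1)/j!`);
* **`hasSum_taylorRemOp_smul`** — `HasSum (j ↦ (β_j a^j)·Y^j) (R_{n+1}(aY))` in any complete normed ℝ-algebra;
* `remSeries n Y` (def: the formal power series `p_j = β_j Y^j·(x₁⋯x_j)`), `remSeries_radius` (`= ⊤`),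
  **`hasFPowerSeriesOnBall_taylorRemOp`** (on the ball of radius `⊤` at `0`), **`analyticAt_taylorRemOp`** (every `a`),
  `analyticOnNhd_taylorRemOp` (`univ`), `contDiff_taylorRemOp`;
* the printed instance **`analyticAt_remOp_q`**: `A ↦ R_{n̄+1}(qe(L^kε)A)` (the tensor of (1.15); for (1.9)/(1.11) the argument
  is `−ηqe(L^kε)Ã_b`, the same function at `−ηA`) is analytic at every `A ∈ ℝ`.
HONEST SCOPE: exactly the analyticity clause; "values in linear operators on ℝ^N" = the instance `𝔸 = ℝ^N →L[ℝ] ℝ^N`.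
-/

open scoped BigOperators
open NormedSpace

namespace Literature.MathematicalPhysics.QuantumFieldTheory.Balaban1983to89.B3Eq115RemainderAnalytic

open Literature.MathematicalPhysics.QuantumFieldTheory.Balaban1983to89.B3VertexTensorBounds (taylorRemOp)
open Literature.MathematicalPhysics.QuantumFieldTheory.Balaban1983to89.HiggsLattice (ChargeData)

noncomputable section

/-! ## §1. The Taylor coefficients `β_j(n) = (n+1)∫₀¹(1−t)ⁿ t^j/j! dt` -/

/-- `β_j(n) := (n+1)∫₀¹(1−t)ⁿ t^j/j! dt`, the `j`-th power-series coefficient of `R_{n+1}` ((I.3.14) with `e^{tz}` expanded).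
[cite: Balaban1982Higgs1, (3.14) p.614] -/
def remCoeff (n j : ℕ) : ℝ :=
  ((n : ℝ) + 1) * ∫ t in (0:ℝ)..1, (1 - t) ^ n * t ^ j / (j.factorial : ℝ)

/-- The integrand of `β_j(n)` is bounded by `1/j!` on `[0,1]`. [folklore] -/
private theorem kernel_le (n j : ℕ) {t : ℝ} (ht : t ∈ Set.uIoc (0:ℝ) 1) :
    ‖(1 - t) ^ n * t ^ j / (j.factorial : ℝ)‖ ≤ 1 / (j.factorial : ℝ) := by
  rw [Set.uIoc_of_le zero_le_one, Set.mem_Ioc] at ht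
  have h1 : |1 - t| ≤ 1 := by rw [abs_le]; constructor <;> linarith
  have h2 : |t| ≤ 1 := by rw [abs_le]; constructor <;> linarith
  have hj : (0 : ℝ) < j.factorial := Nat.cast_pos.mpr (Nat.factorial_pos j)
  rw [Real.norm_eq_abs, abs_div, abs_mul, abs_pow, abs_pow, abs_of_pos hj]
  refine div_le_div_of_nonneg_right ?_ hj.le
  calc |1 - t| ^ n * |t| ^ j ≤ 1 ^ n * 1 ^ j :=
        mul_le_mul (pow_le_pow_left₀ (abs_nonneg _) h1 n) (pow_le_pow_left₀ (abs_nonneg _) h2 j)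
          (pow_nonneg (abs_nonneg _) j) (pow_nonneg zero_le_one n)
    _ = 1 := by rw [one_pow, one_pow, one_mul]

/-- `|β_j(n)| ≦ (n+1)/j!`. [cite: Balaban1982Higgs1, (3.14) p.614] -/
theorem abs_remCoeff_le (n j : ℕ) : |remCoeff n j| ≤ ((n : ℝ) + 1) / (j.factorial : ℝ) := by
  unfold remCoeff
  have hn : (0 : ℝ) ≤ (n : ℝ) + 1 := by positivity
  have hint : ‖∫ t in (0:ℝ)..1, (1 - t) ^ n * t ^ j / (j.factorial : ℝ)‖ ≤ 1 / (j.factorial : ℝ) * |1 - 0| :=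
    intervalIntegral.norm_integral_le_of_norm_le_const fun t ht => kernel_le n j ht
  rw [sub_zero, abs_one, mul_one, Real.norm_eq_abs] at hint
  rw [abs_mul, abs_of_nonneg hn, div_eq_mul_one_div]
  exact mul_le_mul_of_nonneg_left hint hn

/-! ## §2. The power series of `a ↦ R_{n+1}(aY)` -/

section Series

variable {𝔸 : Type*} [NormedRing 𝔸] [NormedAlgebra ℝ 𝔸] [CompleteSpace 𝔸]

/-- On `[0,1]`: `|(1−t)ⁿ t^j| ≦ 1`. [folklore] -/
private theorem weight_le_one (n j : ℕ) {t : ℝ} (ht : t ∈ Set.uIoc (0:ℝ) 1) : |(1 - t) ^ n * t ^ j| ≤ 1 := by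
  rw [Set.uIoc_of_le zero_le_one, Set.mem_Ioc] at ht
  have h1 : |1 - t| ≤ 1 := by rw [abs_le]; constructor <;> linarith
  have h2 : |t| ≤ 1 := by rw [abs_le]; constructor <;> linarith
  rw [abs_mul, abs_pow, abs_pow]
  calc |1 - t| ^ n * |t| ^ j ≤ 1 ^ n * 1 ^ j :=
        mul_le_mul (pow_le_pow_left₀ (abs_nonneg _) h1 n) (pow_le_pow_left₀ (abs_nonneg _) h2 j)
          (pow_nonneg (abs_nonneg _) j) (pow_nonneg zero_le_one n)
    _ = 1 := by rw [one_pow, one_pow, one_mul]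

/-- **`R_{n+1}(aY) = Σ_{j≥0} β_j(n) a^j Y^j`** (convergent for all `a`, `Y`): the exponential series under the integral of
(I.3.14), by dominated convergence. [cite: Balaban1982Higgs1, (3.14) p.614] [cite: Balaban1983Higgs3, p.414 (after (1.15))] -/
theorem hasSum_taylorRemOp_smul (n : ℕ) (Y : 𝔸) (a : ℝ) :
    HasSum (fun j : ℕ => (remCoeff n j * a ^ j) • Y ^ j) (taylorRemOp n (a • Y)) := by
  set X : 𝔸 := a • Y with hX
  -- the summands under the integral, their dominating sequence, and dominated convergence
  set F : ℕ → ℝ → 𝔸 := fun j t => (1 - t) ^ n • (((j.factorial : ℝ)⁻¹) • (t • X) ^ j) with hF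
  set bound : ℕ → ℝ → ℝ := fun j _ => ‖((j.factorial : ℝ)⁻¹) • X ^ j‖ with hbound
  have hF_cont : ∀ j, Continuous (F j) := fun j => by
    simp only [hF]
    fun_prop
  have h_bound : ∀ j, ∀ᵐ t ∂MeasureTheory.volume, t ∈ Set.uIoc (0:ℝ) 1 → ‖F j t‖ ≤ bound j t := fun j =>
    Filter.Eventually.of_forall fun t ht => by
      simp only [hF, hbound]
      rw [smul_pow, smul_comm ((j.factorial : ℝ)⁻¹) (t ^ j) (X ^ j), smul_smul, norm_smul, Real.norm_eq_abs]
      exact mul_le_of_le_one_left (norm_nonneg _) (weight_le_one n j ht)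
  have h_sum : ∀ᵐ t ∂MeasureTheory.volume, t ∈ Set.uIoc (0:ℝ) 1 → Summable fun j => bound j t :=
    Filter.Eventually.of_forall fun t _ => NormedSpace.norm_expSeries_summable' (𝕂 := ℝ) X
  have h_int : IntervalIntegrable (fun t : ℝ => ∑' j, bound j t) MeasureTheory.volume 0 1 := by
    simp only [hbound]
    exact intervalIntegrable_const
  have h_lim : ∀ᵐ t ∂MeasureTheory.volume, t ∈ Set.uIoc (0:ℝ) 1 →
      HasSum (fun j => F j t) ((1 - t) ^ n • exp (t • X)) :=
    Filter.Eventually.of_forall fun t _ => (NormedSpace.exp_series_hasSum_exp' (𝕂 := ℝ) (t • X)).const_smul _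
  have h1 := intervalIntegral.hasSum_integral_of_dominated_convergence bound
    (fun j => (hF_cont j).aestronglyMeasurable) h_bound h_sum h_int h_lim
  -- multiply by `n + 1` and identify the terms
  have h2 : HasSum (fun j => ((n : ℝ) + 1) • ∫ t in (0:ℝ)..1, F j t) (taylorRemOp n X) := h1.const_smul _
  have hFj : ∀ j, F j = fun t => ((1 - t) ^ n * t ^ j / (j.factorial : ℝ) * a ^ j) • Y ^ j := fun j => by
    funext t
    simp only [hF, hX, smul_pow, smul_smul]
    congr 1
    field_simp
    ring
  have h3 : (fun j => ((n : ℝ) + 1) • ∫ t in (0:ℝ)..1, F j t) = fun j => (remCoeff n j * a ^ j) • Y ^ j := by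
    funext j
    rw [hFj j, intervalIntegral.integral_smul_const, intervalIntegral.integral_mul_const, smul_smul]
    unfold remCoeff
    rw [mul_assoc]
  rw [h3] at h2
  exact h2

omit [CompleteSpace 𝔸] in
/-- The formal power series of `a ↦ R_{n+1}(aY)` at `0`: `p_j(x₁,…,x_j) = (x₁⋯x_j)·β_j(n)Y^j`. [cite: Balaban1982Higgs1, (3.14) p.614] -/
def remSeries (n : ℕ) (Y : 𝔸) : FormalMultilinearSeries ℝ ℝ 𝔸 := fun j =>
  ContinuousMultilinearMap.mkPiRing ℝ (Fin j) (remCoeff n j • Y ^ j)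

omit [CompleteSpace 𝔸] in
/-- The series has infinite radius of convergence (`|β_j| ≦ (n+1)/j!`). [cite: Balaban1982Higgs1, (3.14) p.614] -/
theorem remSeries_radius (n : ℕ) (Y : 𝔸) : (remSeries n Y).radius = ⊤ := by
  refine FormalMultilinearSeries.radius_eq_top_of_summable_norm _ fun r => ?_
  have hg : Summable fun j : ℕ => ((n : ℝ) + 1) * ‖((j.factorial : ℝ)⁻¹) • ((r : ℝ) • Y) ^ j‖ :=
    (NormedSpace.norm_expSeries_summable' (𝕂 := ℝ) ((r : ℝ) • Y)).mul_left _
  refine Summable.of_nonneg_of_le (fun j => by positivity) (fun j => ?_) hg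
  simp only [remSeries, ContinuousMultilinearMap.norm_mkPiRing]
  rw [smul_pow, smul_smul, norm_smul, norm_smul, Real.norm_eq_abs, Real.norm_eq_abs, abs_mul, abs_inv, Nat.abs_cast,
    abs_pow, NNReal.abs_eq]
  have hβ := abs_remCoeff_le n j
  have hj : (0 : ℝ) < j.factorial := Nat.cast_pos.mpr (Nat.factorial_pos j)
  rw [div_eq_mul_inv] at hβ
  calc |remCoeff n j| * ‖Y ^ j‖ * (r : ℝ) ^ j = |remCoeff n j| * ((r : ℝ) ^ j * ‖Y ^ j‖) := by ring
    _ ≤ ((n : ℝ) + 1) * (j.factorial : ℝ)⁻¹ * ((r : ℝ) ^ j * ‖Y ^ j‖) :=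
        mul_le_mul_of_nonneg_right hβ (by positivity)
    _ = ((n : ℝ) + 1) * ((j.factorial : ℝ)⁻¹ * (r : ℝ) ^ j * ‖Y ^ j‖) := by ring

/-- **`a ↦ R_{n+1}(aY)` has the power series `remSeries` on the whole line** (ball of radius `⊤` at `0`).
[cite: Balaban1982Higgs1, (3.14) p.614] [cite: Balaban1983Higgs3, p.414 (after (1.15))] -/
theorem hasFPowerSeriesOnBall_taylorRemOp (n : ℕ) (Y : 𝔸) :
    HasFPowerSeriesOnBall (fun a : ℝ => taylorRemOp n (a • Y)) (remSeries n Y) 0 ⊤ := by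
  refine HasFPowerSeriesOnBall.mk (by rw [remSeries_radius]) (by simp) fun {y} _ => ?_
  have h := hasSum_taylorRemOp_smul n Y y
  rw [zero_add]
  have hterm : (fun j => remSeries n Y j fun _ => y) = fun j => (remCoeff n j * y ^ j) • Y ^ j := by
    funext j
    simp only [remSeries, ContinuousMultilinearMap.mkPiRing_apply, Finset.prod_const, Finset.card_univ,
      Fintype.card_fin, smul_smul]
    congr 1
    ring
  rw [hterm]
  exact h

/-- **p. 414: *"R_{n̄+1}(qA) is an analytic function of A ∈ R"*** — for every element `Y` of a complete normed real algebra
and every `n`, `a ↦ R_{n+1}(aY)` is analytic at every `a ∈ ℝ`. [cite: Balaban1983Higgs3, p.414 (after (1.15))]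
[cite: Balaban1982Higgs1, (3.14) p.614] -/
theorem analyticAt_taylorRemOp (n : ℕ) (Y : 𝔸) (a : ℝ) : AnalyticAt ℝ (fun a : ℝ => taylorRemOp n (a • Y)) a :=
  (hasFPowerSeriesOnBall_taylorRemOp n Y).analyticAt_of_mem (Metric.mem_eball.mpr (edist_lt_top a 0))

/-- The same on the whole line. [cite: Balaban1983Higgs3, p.414 (after (1.15))] -/
theorem analyticOnNhd_taylorRemOp (n : ℕ) (Y : 𝔸) : AnalyticOnNhd ℝ (fun a : ℝ => taylorRemOp n (a • Y)) Set.univ :=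
  fun a _ => analyticAt_taylorRemOp n Y a

/-- Hence smooth. [cite: Balaban1983Higgs3, p.414 (after (1.15))] -/
theorem contDiff_taylorRemOp (n : ℕ) (Y : 𝔸) {m : WithTop ℕ∞} : ContDiff ℝ m (fun a : ℝ => taylorRemOp n (a • Y)) :=
  (analyticOnNhd_taylorRemOp n Y).contDiff

end Series

/-! ## §3. The printed instance: `R_{n̄+1}(qe(L^kε)A)`, linear operators on `ℝ^N` -/

section Printed

variable {N : ℕ} (C : ChargeData N)

/-- **[B3] p. 414, as printed: `A ↦ R_{n̄+1}(qe(L^kε)A)` (the tensor of (1.15), values in the linear operators on `ℝ^N`) is an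
analytic function of `A ∈ ℝ`.** [cite: Balaban1983Higgs3, p.414 (after (1.15))] -/
theorem analyticAt_remOp_q (nbar : ℕ) (A : ℝ) :
    AnalyticAt ℝ (fun A : ℝ => taylorRemOp nbar ((C.e * A) • C.q)) A := by
  have h : (fun A : ℝ => taylorRemOp nbar ((C.e * A) • C.q)) = fun A : ℝ => taylorRemOp nbar (A • (C.e • C.q)) := by
    funext A
    rw [smul_smul, mul_comm]
  rw [h]
  exact analyticAt_taylorRemOp nbar (C.e • C.q) A

/-- The bond form of (1.9)/(1.11): `A ↦ R_{n̄+1}(−ηqe(L^kε)A)` is analytic in `A ∈ ℝ` (`η = P.mesh k` or any real).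
[cite: Balaban1983Higgs3, (1.9) p.413] -/
theorem analyticAt_remOp_q_bond (nbar : ℕ) (η A : ℝ) :
    AnalyticAt ℝ (fun A : ℝ => taylorRemOp nbar ((-(η * C.e * A)) • C.q)) A := by
  have h : (fun A : ℝ => taylorRemOp nbar ((-(η * C.e * A)) • C.q))
      = fun A : ℝ => taylorRemOp nbar (A • ((-(η * C.e)) • C.q)) := by
    funext A
    rw [smul_smul]
    congr 2
    ring
  rw [h]
  exact analyticAt_taylorRemOp nbar ((-(η * C.e)) • C.q) A

end Printed

end

end Literature.MathematicalPhysics.QuantumFieldTheory.Balaban1983to89.B3Eq115RemainderAnalytic
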